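import Mathlib
import HarnessLib
import Summits.ValiantsHypothesis.ValiantsHypothesis.Theses.MonotoneRestoration
import Summits.ValiantsHypothesis.ValiantsHypothesis.Theorems.MonotoneRestorationMonotoneRestorationQPZetaPatterns
import Literature.Computability.AlgebraicComplexity.PatternExpressions
import Literature.Computability.AlgebraicComplexity.DawarWilsenach2025
import Literature.Computability.AlgebraicComplexity.DawarWilsenach2025Proofs
import Literature.Combinatorics.SimpleGraph.TreeDecomposition

/-!
# Crux `OrbitRestorationQP` (stmt-ValiantsHypothesis-18293) — line `pattern-width`
(crux-strategist s1, 2026-08-17; skeleton, registered with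
`ledger skeleton check …/Cruxes/OrbitRestorationQP/Lines/pattern_width.lean --crux stmt-ValiantsHypothesis-18293`)

THE CUT.  X = `OrbitRestorationQP` (matrix-symmetric `VP` families over `ℂ` have square-symmetric
circuits of quasi-polynomial ORBIT size) is cut along the finite-model-theory / circuit seam in the
ALGEBRAIC pattern currency of Dawar–Pago–Seppelt / Dwivedi–Pago–Seppelt (homomorphism polynomials
`homPoly`, treewidth `Literature.Combinatorics.SimpleGraph.treewidth` of the pattern graph, labelled
pattern expressions `PatternExpr` / `PatternExpr.close`) — NOT in the `0/1`-shadow counting-width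
currency of the route header's foreseen cut (a), whose converse half ("polylog counting width ⇒ qp
orbit") is itself `VP`-load-bearing (witness `per · Π_ij (x_ij² - x_ij)`: shadow `≡ 0`, in `VP` iff
`per` is, by Kaltofen factor closure) and open.  Here only the first piece carries the summit:

* `stub_homWidthReduction` (A1, summit-carrying, the TRANSFER of X): a matrix-symmetric `VP` family
  is, at every order `n ≥ 1`, a `ℂ`-linear combination of homomorphism polynomials of bipartite
  multigraph patterns of treewidth `≤ w` with `n^(w+1) ≤ 2^((log₂ n + c)^c)` (polylog treewidth) —
  of ARBITRARY volume, dimension and multiplicity (cancellations allowed).  The quasi-polynomial,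
  cancellation-tolerant form of Dawar–Pago–Seppelt 2025 Thm 1.1 (there: for poly-ORBIT symmetric
  circuits, bounded treewidth) asked for `VP` — Dwivedi–Pago–Seppelt 2026 Outlook Q3 (p. 12) is its
  linear-volume / poly-dimension instance.  No symmetric circuit, automorphism or orbit occurs in A1.
* `stub_exprOfTreewidth` (A2, `VH`-free combinatorics): a linear combination of hom polynomials of
  patterns of treewidth `≤ w` is, at each order `n ≥ 1`, the closed polynomial of ONE labelled pattern
  expression with `w+1` row and `w+1` column labels (dynamic programming along tree decompositions
  with label reuse = register allocation on a chordal graph of clique number `≤ w+1`; unused labels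
  cost factors `n`, repaid by constants `n⁻¹` — hence `ℂ` and `n ≥ 1`).  The folklore left
  unformalised in `Literature/…/PatternExpressions.lean` (module docstring) and the easy direction of
  Dawar–Pago–Seppelt 2025 Thm 5.3 in expression form.
* `stub_orbitOfPattern` (B, `VH`-free circuits; the ORBIT FORM OF COROLLARY ζ-P): the closed
  polynomial of a width-`(k,l)` expression has a square-symmetric circuit of ORBIT size
  `≤ d · (n^(k+l) + n² + 1)^d` for an absolute `d`, WHATEVER THE LENGTH of the expression (the size
  form `qpSymmetric_patternExpr` needs `|e| ≤ qp`).  Route to it: the tree's ζ-synthesis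
  `zeta_symmetric_patternExpr` with every expression node pinned by a private pair of constant gates
  (`add K_u`, `add K'_u`, `κ'_u = -κ_u`), so that EVERY automorphism (Dawar–Wilsenach `autOrbit` ranges
  over all automorphisms extending some `σ`, not over a designed action) preserves the node fibration
  (constant gates are fixed: `IsAutomorphismExtending.apply_eq_self_of_label_const`; values move by
  `rename`: `IsAutomorphismExtending.eval_apply`); an automorphism-invariant tag with fibres of size
  `≤ B` bounds `orbitSize ≤ B` — no rigidification (Dwivedi–Pago–Seppelt 2026 Lem 2.4 produces
  multi-edges, which the tree's `Finset`-children model lacks) is needed.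

PROVED HERE (no sorry of its own): `orbit_arith` (the exponent bookkeeping) and the composition
`OrbitRestorationQP_of : OrbitRestorationQP` from the three stubs used by name (A1, A2, B) (order `0`: a one-gate constant circuit,
`orbitSize ≤ size`; orders `≥ 1`: A1, A2 with `k = l = w+1`, B, and
`d (n^(2w+2) + n² + 1)^d ≤ (d 2^d) (n+2)^(2d) 2^(2d (log₂ n + c)^c) ≤ 2^((log₂ n + c₃)^c₃)`,
`zeta_poly_mul_qp_le`).

DISPROOF USED.  `Negative/OrbitRestorationFalseWithoutVP.lean` (`orbitRestoration_false_without_VP`: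
the `VP` hypothesis of X is load-bearing, witness `per`): honoured at A1, the only stub carrying
`IsVPFamily` (A2 and B are unconditional constructions; by A2∘B, `per` has no polylog-treewidth hom
expansion of any volume — Dawar–Wilsenach Thm 7.1 in pattern dress);
`Negative/OrbitRestorationFalseOfPolylogWidthVP.lean` (`stub_orbitRestoration_false_of_polylogWidthVP :
PolylogWidthVP → ¬X`): since A1 → X here, a polylog-(counting-)width VP family refutes A1 too, and by
Dvořák / Dell–Grohe–Rattan (tree `Literature/ModelTheory/FiniteModelTheory/CkEquivHomCount.lean`) the
values of polylog-treewidth hom combinations cannot separate `≡^{C^polylog}` pairs, so A1's kill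
witness is EXACTLY X's (`PolylogWidthVP`), no new one; `Negative/UniformExponentFalse.lean`: A1 keeps
`∃ c` after `∀ f`; `Negative/DimensionCounting.lean` (`symmetricCheapSpan_not_qpSize`) concerns SIZE and
does not bear on orbit statements.
-/

noncomputable section

-- `Summit.ValiantsHypothesis.ValiantsHypothesis.…` is the tree's mandated namespace (Sub = Summit).
set_option linter.dupNamespace false

namespace Summit.ValiantsHypothesis.ValiantsHypothesis.Cruxes.OrbitRestorationQP.PatternWidth

open Summit.ValiantsHypothesis.ValiantsHypothesis.Theses.MonotoneRestoration
open Summit.ValiantsHypothesis.ValiantsHypothesis.Theorems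
open Literature.Computability.AlgebraicComplexity

/-! ### The three stubs -/

/-- **A1 — HOM-WIDTH REDUCTION (summit-carrying; the transfer of the crux into pattern currency).**
Every matrix-symmetric `VP` family over `ℂ` is, at each order `n ≥ 1`, a `ℂ`-linear combination of
homomorphism polynomials `homPoly (E i) n ℂ` of bipartite multigraph patterns
`E i : Multiset (Fin (a i) × Fin (b i))` whose pattern graphs (on `Fin (a i) ⊕ Fin (b i)`) have
treewidth `≤ w`, where `n^(w+1) ≤ 2^((log₂ n + c)^c)`; volume `a i + b i`, dimension `m` and
multiplicities are unrestricted.  Open: the `VP`-version of Dawar–Pago–Seppelt 2025 Thm 1.1 at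
quasi-polynomial scale (Dwivedi–Pago–Seppelt 2026 Outlook Q3 is its linear-volume instance).
[cite: DawarPagoSeppelt2025, Thm 1.1; DwivediPagoSeppelt2026, Outlook Q3 (p. 12), Cor 3.3 (p. 9)] -/
theorem stub_homWidthReduction :
    ∀ f : (n : ℕ) → MvPolynomial (Fin n × Fin n) ℂ,
      (∀ (n : ℕ) (σ τ : Equiv.Perm (Fin n)),
        MvPolynomial.rename (fun p : Fin n × Fin n => (σ p.1, τ p.2)) (f n) = f n) →
      IsVPFamily f →
      ∃ c : ℕ, ∀ n : ℕ, 1 ≤ n →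
        ∃ (w m : ℕ) (a b : Fin m → ℕ) (E : (i : Fin m) → Multiset (Fin (a i) × Fin (b i)))
          (α : Fin m → ℂ),
          n ^ (w + 1) ≤ 2 ^ ((Nat.log 2 n + c) ^ c) ∧
          (∀ i, Literature.Combinatorics.SimpleGraph.treewidth
              (_root_.SimpleGraph.fromRel fun u v : Fin (a i) ⊕ Fin (b i) =>
                ∃ p ∈ E i, u = Sum.inl p.1 ∧ v = Sum.inr p.2) ≤ w) ∧
          f n = ∑ i, MvPolynomial.C (α i) * homPoly (E i) n ℂ := by
  sorry

/-- **A2 — EXPRESSIONS FROM TREE DECOMPOSITIONS (`VH`-free).** At every order `n ≥ 1`, a linear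
combination of homomorphism polynomials of bipartite multigraph patterns of treewidth `≤ w` is the
closed polynomial of one labelled pattern expression with `w + 1` row and `w + 1` column labels
(dynamic programming along a tree decomposition, labels reused as registers; unused labels are
repaid by constants `n⁻¹`).  The folklore direction of Dawar–Pago–Seppelt 2025 Thm 5.3 in the
expression calculus of `Literature/…/PatternExpressions.lean`. [cite: DawarPagoSeppelt2025, Thm 5.3, §5] -/
theorem stub_exprOfTreewidth :
    ∀ (w m n : ℕ) (a b : Fin m → ℕ) (E : (i : Fin m) → Multiset (Fin (a i) × Fin (b i)))
      (α : Fin m → ℂ), 1 ≤ n →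
      (∀ i, Literature.Combinatorics.SimpleGraph.treewidth
          (_root_.SimpleGraph.fromRel fun u v : Fin (a i) ⊕ Fin (b i) =>
            ∃ p ∈ E i, u = Sum.inl p.1 ∧ v = Sum.inr p.2) ≤ w) →
      ∃ e : PatternExpr ℂ (w + 1) (w + 1),
        e.close n = ∑ i, MvPolynomial.C (α i) * homPoly (E i) n ℂ := by
  sorry

/-- **B — ORBIT FORM OF COROLLARY ζ-P (`VH`-free).** There is an absolute `d` such that, for `n ≥ 1`,
the closed polynomial of every pattern expression with `k` row and `l` column labels is computed by a
square-symmetric circuit of Dawar–Wilsenach ORBIT size `≤ d · (n^(k+l) + n² + 1)^d` — independent of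
the length of the expression.  (ζ-synthesis `zeta_symmetric_patternExpr` with every node pinned by
private constants, plus: an automorphism-invariant tag with fibres `≤ B` gives `orbitSize ≤ B`;
Dawar–Pago–Seppelt 2025 Lem 2.2 / Thm 5.3 give the rigid-circuit version.)
[cite: DawarPagoSeppelt2025, Thm 5.3, Lem 2.2; DwivediPagoSeppelt2026, Lem 2.4, §5 (p. 20)] -/
theorem stub_orbitOfPattern :
    ∃ d : ℕ, ∀ (k l n : ℕ) (e : PatternExpr ℂ k l), 1 ≤ n →
      ∃ (G : Type) (_ : Fintype G) (C : LabelledArithCircuit ℂ (Fin n × Fin n) Unit G),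
        C.IsSymmetric (Equiv.Perm (Fin n)) ∧ C.eval (C.output ()) = e.close n ∧
        C.orbitSize (Equiv.Perm (Fin n)) ≤ d * (n ^ (k + l) + n * n + 1) ^ d := by
  sorry

/-! ### Proved: exponent bookkeeping and the composition -/

/-- Exponent bookkeeping: with `n^(w+1) ≤ 2^E`, `E = (log₂ n + c)^c`, the orbit bound of B at
`k = l = w + 1` is `≤ (d 2^d) (n+2)^(2d) 2^(2d E)`. [folklore] -/
theorem orbit_arith (d n w c : ℕ) (hw : n ^ (w + 1) ≤ 2 ^ ((Nat.log 2 n + c) ^ c)) :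
    d * (n ^ (w + 1 + (w + 1)) + n * n + 1) ^ d ≤
      d * 2 ^ d * (n + 2) ^ (2 * d) * 2 ^ (2 * d * (Nat.log 2 n + c) ^ c) := by
  set t := 2 ^ ((Nat.log 2 n + c) ^ c) with ht
  set P := n + 2 with hP
  have ht1 : 1 ≤ t := Nat.one_le_two_pow
  have htt : 1 ≤ t * t := le_trans (by norm_num) (Nat.mul_le_mul ht1 ht1)
  have hP1 : 1 ≤ P ^ 2 := Nat.one_le_pow _ _ (by omega)
  have h1 : n ^ (w + 1 + (w + 1)) ≤ t * t := by
    rw [pow_add]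
    exact Nat.mul_le_mul hw hw
  have h2 : n * n + 1 ≤ P ^ 2 := by
    rw [hP]
    nlinarith
  have h3 : n ^ (w + 1 + (w + 1)) + n * n + 1 ≤ 2 * (t * t) * P ^ 2 := by
    have := Nat.mul_le_mul htt hP1
    nlinarith [h1, h2, htt, hP1, this]
  have key : 2 ^ (2 * d * (Nat.log 2 n + c) ^ c) = t ^ (2 * d) := by
    rw [ht, ← pow_mul]
    congr 1
    ring
  calc d * (n ^ (w + 1 + (w + 1)) + n * n + 1) ^ d
      ≤ d * (2 * (t * t) * P ^ 2) ^ d := Nat.mul_le_mul_left d (Nat.pow_le_pow_left h3 d)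
    _ = d * 2 ^ d * P ^ (2 * d) * t ^ (2 * d) := by
        rw [mul_pow, mul_pow, ← pow_mul, pow_mul' t 2 d, pow_two]
        ring
    _ = d * 2 ^ d * P ^ (2 * d) * 2 ^ (2 * d * (Nat.log 2 n + c) ^ c) := by rw [key]

/-- **THE LINE CONCLUDES THE CRUX**: `OrbitRestorationQP` from the three registered stubs, used BY NAME
(`stub_homWidthReduction` = A1, `stub_exprOfTreewidth` = A2, `stub_orbitOfPattern` = B); no other `sorry`.
Order `0`: `f 0` is a constant, computed by a one-gate circuit (`zeta_symmetric_constant`), and an orbit is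
a set of gates (`orbitSize_le_size`).  Orders `n ≥ 1`: A1 gives the hom expansion of treewidth `w`, A2 one
expression with `w+1` row and column labels, B its circuit of orbit size
`≤ d (n^(2w+2) + n² + 1)^d ≤ (d 2^d)(n+2)^(2d) 2^(2d (log₂ n + c)^c) ≤ 2^((log₂ n + c₃)^c₃)`
(`orbit_arith`, `zeta_poly_mul_qp_le`). [new] -/
theorem OrbitRestorationQP_of :
    Summit.ValiantsHypothesis.ValiantsHypothesis.Theses.MonotoneRestoration.OrbitRestorationQP := by
  intro f hs hVP
  obtain ⟨c, hc⟩ := stub_homWidthReduction f hs hVP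
  obtain ⟨d, hd⟩ := stub_orbitOfPattern
  obtain ⟨c₃, hc₃⟩ := zeta_poly_mul_qp_le (d * 2 ^ d) (2 * d) c (2 * d)
  refine ⟨c₃, fun n => ?_⟩
  rcases Nat.eq_zero_or_pos n with rfl | hn
  · -- order `0`: no variables, `f 0` is a constant
    obtain ⟨G, inst, C, hC, hev, hcard⟩ := zeta_symmetric_constant (X := Fin 0 × Fin 0)
      (Γ := Equiv.Perm (Fin 0)) (MvPolynomial.coeff 0 (f 0))
    refine ⟨G, inst, C, hC, ?_, ?_⟩
    · rw [hev]
      exact (MvPolynomial.eq_C_of_isEmpty (f 0)).symm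
    · exact (C.orbitSize_le_size (Equiv.Perm (Fin 0))).trans (hcard.trans Nat.one_le_two_pow)
  · obtain ⟨w, m, a, b, E, α, hw, htw, hf⟩ := hc n hn
    obtain ⟨e, he⟩ := stub_exprOfTreewidth w m n a b E α hn htw
    obtain ⟨G, inst, C, hC, hev, horb⟩ := hd (w + 1) (w + 1) n e hn
    exact ⟨G, inst, C, hC, by rw [hev, he, hf],
      horb.trans ((orbit_arith d n w c hw).trans (hc₃ n))⟩

end Summit.ValiantsHypothesis.ValiantsHypothesis.Cruxes.OrbitRestorationQP.PatternWidth

end
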